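import Mathlib
import HarnessLib
import Summits.NavierStokesRegularity.NavierStokesRegularity.Theorems.QuarterLogPincerTypeIQuantSubcubicExpFlatWindowExplicitWindow

/-!
# ARM B certificate format (ns-wall-extremal, wall H3): DSS-factor exclusion windows `λ ∈ (1, λ₀]`
  — TABLE FORMAT + kernel SOUNDNESS, stated BY NAME in the tree's near-one vocabulary

Lean-certificate side of experiment arm B (director-ns dss_99 / req171; re-keyed seat ns-crc-p2 g4):
a `native_decide`/kernel-replayable TABLE FORMAT whose rows a compute job emits, a total Boolean
`check`, and a soundness theorem concluding a statement spelled BY NAME against the tree — the pattern of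
the 24850 Phase-I certificate (data module + one `native_decide` line, computational lane).

## A. The excluded-window statement (PDE level, by name)

`ExcludedDssWindow C₀ λ₀` : every `λ`-DSS classical ancient solution `(u,p)` of Navier–Stokes on
`(−∞,0) × ℝ³` (`ν = 1`, zero force) in the Type-I envelope class `HasTypeIDecay C₀ u` with factor
`1 < λ ≤ λ₀` vanishes identically — VERBATIM the conclusion shape of the tree rung
`FlatWindow.removingDss_explicitWindow` (p633176, crux 24077 line `flat_window`, Pineau–Vicol / Chae–Wolf),
with the window END-POINT exposed by name.  The tree proves it for `λ₀ = exp(δ₀/(2B))` from two analytic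
inputs with constants: a ONE-SLICE THRESHOLD `OneSliceThreshold C₀ δ₀` and an ACCELERATION BOUND
`AccelerationBound C₀ B` (both PROVED existentially in the tree: `oneSliceThreshold_exists`,
`stub_accelerationBound`; `SliceDictionary` and `AnnulusPressure` are proved outright and carry no window
constant).  CONSEQUENCE FOR ARM B: a PDE-level «largest certified λ₀» is EXACTLY `exp(δ₀*/(2B*))` for the
best EXPLICIT pair `(δ₀*, B*)` anybody PROVES; no such explicit pair exists in the tree today (the rung's
window is a formula in two effective-in-principle constants).

## B. Row kind W (window-assembly rows; exact rational arithmetic, kernel-replayed)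

`WindowRow := {C₀ δ₀ B lam : ℚ, terms : ℕ}`; `check` = positivity + `1 < lam` +
`lam ≤ expLB (δ₀/(2B)) terms` where `expLB x k = Σ_{i<k} xⁱ/i!` is a rational LOWER bound of `exp x`
(`x ≥ 0`; `Real.sum_le_exp_of_nonneg`).  `WindowRow.sound : r.check = true → r.Inputs →
ExcludedDssWindow r.C₀ r.lam`, where `r.Inputs := OneSliceThreshold r.C₀ r.δ₀ ∧ AccelerationBound r.C₀ r.B`
are the two explicit-constant analytic inputs BY NAME (tree predicates of `QuarterLogPincerFlatWindowDefs`).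
What is TRUSTED: nothing numerical — the kernel re-derives `lam ≤ exp(δ₀/2B)`; what is NOT supplied by a
table: the two `Inputs` (they are theorems to be proved, or hypotheses making the row CONDITIONAL — the
gate records a conditional result exactly as for named Literature facts).  Tables: `List WindowRow`,
`Table.check`, `Table.sound`.

## C. Row kind M (MODEL rows) — sibling file `…DssWindowCertModel.lean`

Finite-dimensional Lyapunov certificates for engine-declared Galerkin truncations `x' = Ax + Q(x,x)` (an
energy threshold below which the MODEL has no non-zero periodic orbit, i.e. no truncated DSS profile of
ANY factor): schema `QuadModel`/`LyapRow`, exact `LDLᵀ` check and the PROVED model-agnostic soundness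
`LyapRow.sound : r.check = true → ModelNoPeriodicOrbitBelow r.model r.Mth` live in the sibling module
`TypeIQuarterGateScarEnvelopeTypeIDssWindowCertModel`; the correspondence model ↔ Leray truncation is
engine metadata; MODEL numbers are never PDE numbers.

Nothing here bears on Navier–Stokes regularity; every statement concerns HYPOTHETICAL DSS blow-up profiles
in the Type-I envelope class; no open item is closed and no summit statement is proved by this file.
-/

noncomputable section

-- the summit-side namespace repeats a component by design (single-conjunct summit, D-0017)
set_option linter.dupNamespace false

namespace Summit.NavierStokesRegularity.NavierStokesRegularity.Cruxes.ScarEnvelopeTypeI.DssWindowCert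

open MeasureTheory Set Function Filter Topology Metric
open Literature.Analysis Literature.Analysis.FluidPDE
open Summit.NavierStokesRegularity.NavierStokesRegularity.Cruxes.TypeIQuantSubcubicExp.FlatWindow

/-! ## A. The excluded window, by name -/

/-- **`λ`-DSS exclusion window `(1, λ₀]` in the Type-I envelope class `C₀`** (PDE level): every
`λ`-DSS classical ancient solution of Navier–Stokes on `(−∞,0) × ℝ³` (`ν = 1`, zero force) with
`HasTypeIDecay C₀ u` and `1 < λ ≤ λ₀` vanishes identically — the conclusion of the tree rung
`FlatWindow.removingDss_explicitWindow` with the window end-point `λ₀` named. -/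
def ExcludedDssWindow (C₀ lam : ℝ) : Prop :=
  ∀ c : ℝ, 1 < c → c ≤ lam →
    ∀ (u : ℝ → EuclideanSpace ℝ (Fin 3) → EuclideanSpace ℝ (Fin 3)) (p : ℝ → EuclideanSpace ℝ (Fin 3) → ℝ),
      IsClassicalNSSolutionOn (Iio 0) 1 0 u p → IsDiscretelySelfSimilar c u → HasTypeIDecay C₀ u →
      ∀ t < 0, ∀ x, u t x = 0

/-- Windows shrink: an excluded window contains every smaller window. -/
theorem ExcludedDssWindow.anti {C₀ lam lam' : ℝ} (h : ExcludedDssWindow C₀ lam) (hle : lam' ≤ lam) :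
    ExcludedDssWindow C₀ lam' :=
  fun c hc hcl u p hsol hdss hdec => h c hc (hcl.trans hle) u p hsol hdss hdec

/-- **Window from explicit inputs.** A one-slice threshold `δ₀` and an acceleration bound `B > 0` for
the envelope constant `C₀ > 0` exclude every window end-point `λ₀ ≤ exp(δ₀/(2B))` — the tree's
`removingDss_window_of` with the constant-free inputs `SliceDictionary` (`stub_sliceDictionary`) and
`AnnulusPressure` (`stub_annulusPressure`) discharged by their landed proofs. -/
theorem excludedDssWindow_of_inputs {C₀ δ₀ B lam : ℝ} (hC₀ : 0 < C₀)
    (hT : OneSliceThreshold C₀ δ₀) (hA : AccelerationBound C₀ B) (hB : 0 < B)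
    (hlam : lam ≤ Real.exp (δ₀ / (2 * B))) : ExcludedDssWindow C₀ lam := by
  intro c hc hcl u p hsol hdss hdec
  obtain ⟨Cp, hCp, hP⟩ := stub_annulusPressure C₀ hC₀
  have hwin : Real.log c ≤ δ₀ / (2 * B) := by
    have := Real.log_le_log (lt_trans zero_lt_one hc) (hcl.trans hlam)
    rwa [Real.log_exp] at this
  exact removingDss_window_of stub_sliceDictionary hT hA hB hCp hP c hc hwin u p hsol hdss hdec

/-- **Some window exists for every envelope constant** (non-explicit): the tree rung
`removingDss_explicitWindow` read through `ExcludedDssWindow`. -/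
theorem excludedDssWindow_exists (C₀ : ℝ) (hC₀ : 0 < C₀) : ∃ lam : ℝ, 1 < lam ∧ ExcludedDssWindow C₀ lam := by
  obtain ⟨δ₀, B, hδ₀, hB, hT, hA, -⟩ := removingDss_explicitWindow C₀ hC₀
  refine ⟨Real.exp (δ₀ / (2 * B)), ?_, excludedDssWindow_of_inputs hC₀ hT hA hB le_rfl⟩
  rw [Real.one_lt_exp_iff]; positivity

/-! ## B. Exact arithmetic: a rational lower bound for `exp` -/

/-- Truncated exponential series `Σ_{i<k} xⁱ/i!` over `ℚ` (a LOWER bound of `exp x` for `x ≥ 0`). -/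
def expLB (x : ℚ) (k : ℕ) : ℚ := ∑ i ∈ Finset.range k, x ^ i / (i.factorial : ℚ)

/-- `expLB x k ≤ exp x` for `x ≥ 0` (cast to `ℝ`). -/
theorem expLB_le_exp {x : ℚ} (hx : 0 ≤ x) (k : ℕ) : ((expLB x k : ℚ) : ℝ) ≤ Real.exp (x : ℝ) := by
  have h := Real.sum_le_exp_of_nonneg (show (0 : ℝ) ≤ (x : ℝ) by exact_mod_cast hx) k
  simpa [expLB] using h

/-! ## C. Row kind W: window-assembly rows -/

/-- A WINDOW ROW: envelope constant `C₀`, claimed one-slice threshold `δ₀`, claimed acceleration bound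
`B`, window end-point `lam`, and the number of exponential-series terms the kernel uses. -/
structure WindowRow where
  /-- Type-I envelope constant `C₀` of `HasTypeIDecay C₀` -/
  C₀ : ℚ
  /-- one-slice threshold `δ₀` (input `OneSliceThreshold C₀ δ₀`) -/
  δ₀ : ℚ
  /-- acceleration bound `B` (input `AccelerationBound C₀ B`) -/
  B : ℚ
  /-- window end-point `λ₀`: the row claims exclusion on `(1, λ₀]` -/
  lam : ℚ
  /-- number of terms of the exponential series used by `check` -/
  terms : ℕ

/-- The total Boolean check of a window row (exact rational arithmetic):
positivity of `C₀, δ₀, B`, `1 < lam`, and `lam ≤ Σ_{i<terms} (δ₀/(2B))ⁱ/i!`. -/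
def WindowRow.check (r : WindowRow) : Bool :=
  decide (0 < r.C₀) && decide (0 < r.δ₀) && decide (0 < r.B) && decide (1 < r.lam) &&
    decide (r.lam ≤ expLB (r.δ₀ / (2 * r.B)) r.terms)

/-- The two explicit-constant ANALYTIC INPUTS of a window row, BY NAME (tree predicates of
`QuarterLogPincerFlatWindowDefs`): a one-slice threshold and an acceleration bound at the row's
constants.  A table does not supply them; they are theorems to prove (or hypotheses). -/
def WindowRow.Inputs (r : WindowRow) : Prop :=
  OneSliceThreshold (r.C₀ : ℝ) (r.δ₀ : ℝ) ∧ AccelerationBound (r.C₀ : ℝ) (r.B : ℝ)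

/-- What the check certifies, unpacked over `ℝ`. -/
theorem WindowRow.check_spec (r : WindowRow) (h : r.check = true) :
    0 < (r.C₀ : ℝ) ∧ 0 < (r.δ₀ : ℝ) ∧ 0 < (r.B : ℝ) ∧ 1 < (r.lam : ℝ) ∧
      (r.lam : ℝ) ≤ Real.exp ((r.δ₀ : ℝ) / (2 * (r.B : ℝ))) := by
  simp only [WindowRow.check, Bool.and_eq_true, decide_eq_true_eq] at h
  obtain ⟨⟨⟨⟨hC, hδ⟩, hB⟩, hl⟩, hle⟩ := h
  refine ⟨by exact_mod_cast hC, by exact_mod_cast hδ, by exact_mod_cast hB, by exact_mod_cast hl, ?_⟩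
  have hx : 0 ≤ r.δ₀ / (2 * r.B) := by positivity
  have h1 : ((r.lam : ℚ) : ℝ) ≤ ((expLB (r.δ₀ / (2 * r.B)) r.terms : ℚ) : ℝ) := by exact_mod_cast hle
  have h2 := expLB_le_exp hx r.terms
  have h3 : (((r.δ₀ / (2 * r.B) : ℚ)) : ℝ) = (r.δ₀ : ℝ) / (2 * (r.B : ℝ)) := by push_cast; ring
  rw [h3] at h2
  exact h1.trans h2

/-- **SOUNDNESS of a window row**: a passing row whose two analytic inputs hold excludes its window
`(1, lam]` in its envelope class, BY NAME. -/
theorem WindowRow.sound (r : WindowRow) (h : r.check = true) (hin : r.Inputs) :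
    ExcludedDssWindow (r.C₀ : ℝ) (r.lam : ℝ) := by
  obtain ⟨hC, -, hB, -, hle⟩ := r.check_spec h
  exact excludedDssWindow_of_inputs hC hin.1 hin.2 hB hle

/-! ## D. Tables of window rows -/

/-- A window table: a list of window rows (one data module per job). -/
abbrev Table := List WindowRow

/-- The total Boolean check of a table: every row passes. -/
def Table.check (T : Table) : Bool := T.all WindowRow.check

/-- **SOUNDNESS of a table**: if the table passes and every row's analytic inputs hold, every row's
window is excluded. -/
theorem Table.sound (T : Table) (h : T.check = true) (hin : ∀ r ∈ T, r.Inputs) :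
    ∀ r ∈ T, ExcludedDssWindow (r.C₀ : ℝ) (r.lam : ℝ) := by
  intro r hr
  have hrow : r.check = true := by
    have := List.all_eq_true.mp h r hr
    simpa using this
  exact r.sound hrow (hin r hr)

/-- Self-test (kernel): the row `C₀ = 1, δ₀ = 1, B = 1, λ₀ = 3/2` passes with 6 series terms
(`Σ_{i<6} (1/2)ⁱ/i! = 6331/3840 ≥ 3/2`). -/
example : (WindowRow.mk 1 1 1 (3 / 2) 6).check = true := by decide +kernel

end Summit.NavierStokesRegularity.NavierStokesRegularity.Cruxes.ScarEnvelopeTypeI.DssWindowCert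

end
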